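import Literature.NumberTheory.EllipticCurves.KubertTwoTenProofs
import Literature.NumberTheory.EllipticCurves.RationalTwoTorsionModPIrreducibleProofs
import Literature.NumberTheory.EllipticCurves.SemistableModPImageReducibleProofs
import HarnessLib

/-!
# Crux `FreyModularity` (stmt-ABC-11340), line `Sketch`, reshape 3: Kubert's `X₁(2,10)` theorem
# kills both branches of Serre's dichotomy on a curve with full rational `2`-torsion

Helper toward the registered glue stub `stub_freyFiveIrreducibleGlue` of the line `Sketch`
(`Summits/ABC/ABC/Cruxes/FreyModularity/Lines/Sketch.lean`).  Let `E/ℚ` be an elliptic curve all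
of whose `2`-torsion points are `Γ_ℚ`-fixed (e.g. a Frey curve `y² = x(x − a)(x + b)`), and let
`H = 𝔽₅ P ⊂ E[5]` be a `Γ_ℚ`-stable line.  Serre's dichotomy for semistable curves (1972, §5.4
Prop. 21 ii); the tree's `smul_eq_or_smul_sub_mem_of_isSemistable`) says that `Γ_ℚ` fixes `H`
pointwise or acts trivially on `E[5]/H`.  Both are impossible:

* if `H` is fixed pointwise, `P` is a rational point of order `5` (Galois descent,
  `fixedPoints_eq_range_map_holds`), and with two independent rational `2`-torsion points `T₁, T₂`
  the map `(i, j) ↦ i T₂ + j (T₁ + P)` embeds `ℤ/2 × ℤ/10` into `E(ℚ)` — excluded by **Kubert 1976**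
  (`X₁(2,10)(ℚ)` consists of cusps; PROVED in the tree, `Kubert1976_no_two_ten_holds`);
* if `Γ_ℚ` acts trivially on `E[5]/H`, the quotient isogeny `g : E → E' = E/H` over `ℚ`
  (Silverman *AEC* III.4.12; tree `exists_isogeny_ker_eq_and_comp_eq_nsmul_holds`) carries any
  `Q ∈ E[5] ∖ H` to a `Γ_ℚ`-fixed point of order `5` of `E'`, and `E'[2] = g(E[2])` is again
  rational (`g` is injective on `E[2]` since `#ker g = 5`), so the first case applies to `E'`.

* `stub_glue_dichotomy` — the registered helper stub (the negation of the dichotomy under the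
  rational-`2`-torsion hypothesis); `false_of_rational_two_torsion_of_fixed_five_torsion` — the first
  branch as a theorem.
-/

-- `Summit.<Summit>.<Problem>` is the mandated summit-side namespace (CONVENTIONS §2); for the
-- single-conjunct summit `ABC` the two coincide, so the duplicate `ABC.ABC` is deliberate.
set_option linter.dupNamespace false

noncomputable section

open scoped Classical

open Literature.NumberTheory.EllipticCurves
open WeierstrassCurve Field

namespace Summit.ABC.ABC.Theorems

/-! ### Group theory: `ℤ/2 × ℤ/10` from two `2`-torsion points and a point of order `5` -/

/-- In an abelian group, let `t₁ ≠ t₂` be non-zero with `2t₁ = 2t₂ = 0` and `q` of order `5`.  If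
`k t₂ + m (t₁ + q) = 0` then `2 ∣ k` and `10 ∣ m`. [folklore] -/
theorem two_dvd_and_ten_dvd_of_zsmul_add_zsmul_eq_zero {A : Type*} [AddCommGroup A] {t₁ t₂ q : A}
    (h1 : 2 • t₁ = 0) (h2 : 2 • t₂ = 0) (hq : 5 • q = 0) (ht₁ : t₁ ≠ 0) (ht₂ : t₂ ≠ 0)
    (ht : t₁ ≠ t₂) (hq0 : q ≠ 0) {k m : ℤ} (h : k • t₂ + m • (t₁ + q) = 0) : 2 ∣ k ∧ 10 ∣ m := by
  -- multiples of `2`-torsion points and of `q`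
  have hk2 : ∀ (t : A), 2 • t = 0 → ∀ j : ℤ, (2 * j) • t = 0 := fun t ht j ↦ by
    rw [mul_comm, mul_zsmul, two_zsmul, ← two_nsmul, ht, zsmul_zero]
  have hodd : ∀ (t : A), 2 • t = 0 → ∀ j : ℤ, (2 * j + 1) • t = t := fun t ht j ↦ by
    rw [add_zsmul, hk2 t ht, one_zsmul, zero_add]
  have hq' : (5 : ℤ) • q = 0 := by rw [ofNat_zsmul]; exact hq
  have hq5 : ∀ j : ℤ, (5 * j) • q = 0 := fun j ↦ by
    rw [mul_comm, mul_zsmul, hq', zsmul_zero]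
  haveI : Fact (Nat.Prime 5) := ⟨Nat.prime_five⟩
  have hordq : addOrderOf q = 5 := addOrderOf_eq_prime hq hq0
  -- apply `2 •`: `(2m) • q = 0`, so `5 ∣ 2m`, `5 ∣ m`
  have h2m : (2 * m) • q = 0 := by
    have := congrArg (fun x : A ↦ (2 : ℤ) • x) h
    simp only [zsmul_add, smul_zero, smul_smul] at this
    rwa [hk2 t₂ h2, hk2 t₁ h1, zero_add, zero_add] at this
  have h5m : (5 : ℤ) ∣ m := by
    have h5 : ((addOrderOf q : ℕ) : ℤ) ∣ 2 * m := by
      rw [← addOrderOf_dvd_iff_zsmul_eq_zero] at h2m; exact h2m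
    rw [hordq] at h5
    exact (Int.Prime.dvd_mul' (by norm_num) h5).resolve_left (by norm_num)
  obtain ⟨m', rfl⟩ := h5m
  -- now `m • (t₁ + q) = m' • t₁`
  have hm : (5 * m') • (t₁ + q) = m' • t₁ := by
    rw [zsmul_add, hq5, add_zero, show (5 : ℤ) * m' = 2 * (2 * m') + m' by ring, add_zsmul,
      hk2 t₁ h1, zero_add]
  rw [hm] at h
  -- parity of `m'` and `k`
  rcases Int.even_or_odd m' with ⟨j, hj⟩ | ⟨j, hj⟩
  · -- `m'` even: then `k • t₂ = 0`, so `k` even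
    rw [hj, ← two_mul, hk2 t₁ h1, add_zero] at h
    refine ⟨?_, ⟨j, by rw [hj]; ring⟩⟩
    rcases Int.even_or_odd k with ⟨i, hi⟩ | ⟨i, hi⟩
    · exact ⟨i, by rw [hi]; ring⟩
    · rw [hi, hodd t₂ h2] at h; exact absurd h ht₂
  · -- `m'` odd: `k • t₂ + t₁ = 0` forces `t₁ = 0` or `t₁ = t₂`
    exfalso
    rw [hj, hodd t₁ h1] at h
    rcases Int.even_or_odd k with ⟨i, hi⟩ | ⟨i, hi⟩
    · rw [hi, ← two_mul, hk2 t₂ h2, zero_add] at h; exact ht₁ h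
    · rw [hi, hodd t₂ h2, add_eq_zero_iff_eq_neg, neg_eq_iff_add_eq_zero.mpr
        (by rw [← two_nsmul]; exact h1)] at h
      exact ht h.symm

/-- From two distinct non-zero `2`-torsion points and a point of order `5` in an abelian group, an
injective homomorphism `ℤ/2 × ℤ/10 → A`, `(i, j) ↦ i t₂ + j (t₁ + q)`. [folklore] -/
theorem exists_injective_zmod_two_prod_zmod_ten {A : Type*} [AddCommGroup A] {t₁ t₂ q : A}
    (h1 : 2 • t₁ = 0) (h2 : 2 • t₂ = 0) (hq : 5 • q = 0) (ht₁ : t₁ ≠ 0) (ht₂ : t₂ ≠ 0)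
    (ht : t₁ ≠ t₂) (hq0 : q ≠ 0) : ∃ f : ZMod 2 × ZMod 10 →+ A, Function.Injective f := by
  have h2' : (zmultiplesHom A t₂) (2 : ℕ) = 0 := by
    rw [zmultiplesHom_apply, natCast_zsmul, h2]
  have h10' : (zmultiplesHom A (t₁ + q)) (10 : ℕ) = 0 := by
    rw [zmultiplesHom_apply, natCast_zsmul, nsmul_add, show (10 : ℕ) = 5 * 2 by rfl, mul_nsmul',
      h1, smul_zero, mul_comm, mul_nsmul', hq, smul_zero, add_zero]
  let g₁ : ZMod 2 →+ A := ZMod.lift 2 ⟨zmultiplesHom A t₂, h2'⟩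
  let g₂ : ZMod 10 →+ A := ZMod.lift 10 ⟨zmultiplesHom A (t₁ + q), h10'⟩
  refine ⟨g₁.coprod g₂, (injective_iff_map_eq_zero _).mpr ?_⟩
  rintro ⟨i, j⟩ hij
  rw [AddMonoidHom.coprod_apply] at hij
  have hi : g₁ i = (i.val : ℤ) • t₂ := by
    conv_lhs => rw [← ZMod.natCast_zmod_val i, ← Int.cast_natCast]
    rw [ZMod.lift_coe]; rfl
  have hj : g₂ j = (j.val : ℤ) • (t₁ + q) := by
    conv_lhs => rw [← ZMod.natCast_zmod_val j, ← Int.cast_natCast]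
    rw [ZMod.lift_coe]; rfl
  rw [hi, hj] at hij
  obtain ⟨hk, hm⟩ := two_dvd_and_ten_dvd_of_zsmul_add_zsmul_eq_zero h1 h2 hq ht₁ ht₂ ht hq0 hij
  have hi0 : i = 0 := by
    have := ZMod.val_lt i
    have : (i.val : ℤ) = 0 := by omega
    rw [← ZMod.natCast_zmod_val i, show i.val = 0 by exact_mod_cast this, Nat.cast_zero]
  have hj0 : j = 0 := by
    have := ZMod.val_lt j
    have : (j.val : ℤ) = 0 := by omega
    rw [← ZMod.natCast_zmod_val j, show j.val = 0 by exact_mod_cast this, Nat.cast_zero]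
  rw [hi0, hj0]; rfl

/-! ### Branch 1: a rational point of order `5` next to the rational `2`-torsion -/

/-- **Kubert's theorem in Galois-module form.**  An elliptic curve `E/ℚ` all of whose `2`-torsion
points are `Γ_ℚ`-fixed has no non-zero `Γ_ℚ`-fixed point `P ∈ E(ℚ̄)` with `5P = O`: by Galois
descent (`fixedPoints_eq_range_map_holds`) such a `P` and two independent `2`-torsion points are
rational, giving `ℤ/2 × ℤ/10 ↪ E(ℚ)`, which Kubert 1976 excludes (`X₁(2,10)(ℚ)` = cusps;
`Kubert1976_no_two_ten_holds`). [cite: Kubert1976, Ch. IV (X₁(2,10))] -/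
theorem false_of_rational_two_torsion_of_fixed_five_torsion (W : WeierstrassCurve ℚ) [W.IsElliptic]
    (h2 : ∀ (σ : absoluteGaloisGroup ℚ) (P : W.geomPoints), 2 • P = 0 → σ • P = P)
    {P : W.geomPoints} (hP0 : P ≠ 0) (hP5 : 5 • P = 0)
    (hfix : ∀ σ : absoluteGaloisGroup ℚ, σ • P = P) : False := by
  -- Galois descent: fixed points are rational points of `W₀ = W ⊗ ℚ`
  set b : (W.baseChange ℚ).toAffine.Point →+ W.geomPoints :=
    Affine.Point.baseChange ℚ (AlgebraicClosure ℚ) with hb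
  have hbinj : Function.Injective b := Affine.Point.map_injective _
  have hdesc : ∀ {X : W.geomPoints}, (∀ σ : absoluteGaloisGroup ℚ, σ • X = X) → ∃ x, b x = X := by
    intro X hX
    have hmem : X ∈ MulAction.fixedPoints (absoluteGaloisGroup ℚ) (geomPoints W) := hX
    rw [fixedPoints_eq_range_map_holds W] at hmem
    exact hmem
  -- two independent geometric `2`-torsion points
  have h2K : ((2 : ℕ) : ℚ) ≠ 0 := by norm_num
  haveI : Finite (geomTorsion W ((2 : ℕ) : ℤ)) := finite_geomTorsion_natCast W two_ne_zero
  obtain ⟨T₁, T₂, hT₁2, hT₂2, hT₁0, hT₂0, hT₁₂⟩ :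
      ∃ T₁ T₂ : W.geomPoints, 2 • T₁ = 0 ∧ 2 • T₂ = 0 ∧ T₁ ≠ 0 ∧ T₂ ≠ 0 ∧ T₁ ≠ T₂ := by
    haveI : Fintype (geomTorsion W ((2 : ℕ) : ℤ)) := Fintype.ofFinite _
    have h3 : 2 < Fintype.card (geomTorsion W ((2 : ℕ) : ℤ)) := by
      rw [← Nat.card_eq_fintype_card, natCard_geomTorsion_eq_sq W h2K]; norm_num
    obtain ⟨a, c, d, hac, had, hcd⟩ := Fintype.two_lt_card_iff.1 h3
    have mem2 : ∀ x : geomTorsion W ((2 : ℕ) : ℤ), 2 • (x : W.geomPoints) = 0 := fun x ↦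
      AddSubgroup.torsionBy.nsmul_iff.1 x.2
    have hne : ∀ {x y : geomTorsion W ((2 : ℕ) : ℤ)}, x ≠ y → (x : W.geomPoints) ≠ y :=
      fun hxy h ↦ hxy (Subtype.ext h)
    by_cases ha : (a : W.geomPoints) = 0
    · refine ⟨c, d, mem2 c, mem2 d, fun hc ↦ hne hac (ha.trans hc.symm), fun hd ↦ hne had
        (ha.trans hd.symm), hne hcd⟩
    · by_cases hc : (c : W.geomPoints) = 0
      · exact ⟨a, d, mem2 a, mem2 d, ha, fun hd ↦ hne hcd (hc.trans hd.symm), hne had⟩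
      · exact ⟨a, c, mem2 a, mem2 c, ha, hc, hne hac⟩
  -- descend everything to `W₀(ℚ)`
  obtain ⟨t₁, ht₁⟩ := hdesc (fun σ ↦ h2 σ T₁ hT₁2)
  obtain ⟨t₂, ht₂⟩ := hdesc (fun σ ↦ h2 σ T₂ hT₂2)
  obtain ⟨q, hq⟩ := hdesc hfix
  have hzero : ∀ {x}, b x = 0 → x = 0 := fun {x} hx ↦ hbinj (by rw [hx, map_zero])
  have ht₁2 : 2 • t₁ = 0 := hzero (by rw [map_nsmul, ht₁, hT₁2])
  have ht₂2 : 2 • t₂ = 0 := hzero (by rw [map_nsmul, ht₂, hT₂2])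
  have hq5 : 5 • q = 0 := hzero (by rw [map_nsmul, hq, hP5])
  have ht₁0 : t₁ ≠ 0 := fun h ↦ hT₁0 (by rw [← ht₁, h, map_zero])
  have ht₂0 : t₂ ≠ 0 := fun h ↦ hT₂0 (by rw [← ht₂, h, map_zero])
  have hq0 : q ≠ 0 := fun h ↦ hP0 (by rw [← hq, h, map_zero])
  have ht : t₁ ≠ t₂ := fun h ↦ hT₁₂ (by rw [← ht₁, ← ht₂, h])
  obtain ⟨f, hf⟩ := exists_injective_zmod_two_prod_zmod_ten ht₁2 ht₂2 hq5 ht₁0 ht₂0 ht hq0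
  haveI : (W.baseChange ℚ).IsElliptic := by
    rw [WeierstrassCurve.baseChange, show algebraMap ℚ ℚ = RingHom.id ℚ from rfl,
      WeierstrassCurve.map_id]
    infer_instance
  exact Kubert1976_no_two_ten_holds (W.baseChange ℚ) ⟨f, hf⟩

/-! ### Branch 2 (trivial quotient character) via the quotient isogeny, and the helper stub -/

/-- **Helper stub `stub_glue_dichotomy` of the line `Sketch` (reshape 3): on an elliptic curve over
`ℚ` with `Γ_ℚ`-fixed `2`-torsion, a `Γ_ℚ`-stable subgroup `H` of `E[5]` other than `0` and `E[5]`
is neither fixed pointwise nor has trivial quotient action.**  The first branch is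
`false_of_rational_two_torsion_of_fixed_five_torsion`; in the second, the quotient isogeny
`g : E → E/H` (`exists_isogeny_ker_eq_and_comp_eq_nsmul_holds`, kernel = `H` of order `5`) maps a
point `Q ∈ E[5] ∖ H` to a non-zero `Γ_ℚ`-fixed `5`-torsion point of `E/H` (`g(σQ) = g(Q)` because
`σQ − Q ∈ H = ker g`), and `(E/H)[2] = g(E[2])` is `Γ_ℚ`-fixed (`g` is injective on `E[2]` and both
have four elements), so the first branch applies to `E/H`. [cite: Kubert1976, Ch. IV (X₁(2,10))]
[cite: SilvermanAEC2009, Prop. III.4.12] -/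
theorem stub_glue_dichotomy :
    ∀ (W : WeierstrassCurve ℚ) [W.IsElliptic],
      (∀ (σ : Field.absoluteGaloisGroup ℚ) (P : W.geomPoints), 2 • P = 0 → σ • P = P) →
      ∀ H : AddSubgroup (geomTorsion W (5 : ℕ)),
        (∀ σ : Field.absoluteGaloisGroup ℚ, ∀ P ∈ H, σ • P ∈ H) → H ≠ ⊥ → H ≠ ⊤ →
        ¬ ((∀ σ : Field.absoluteGaloisGroup ℚ, ∀ P ∈ H, σ • P = P) ∨
            ∀ (σ : Field.absoluteGaloisGroup ℚ) (Q : geomTorsion W (5 : ℕ)), σ • Q - Q ∈ H) := by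
  intro W _ h2 H hst hbot htop hdich
  haveI : Fact (Nat.Prime 5) := ⟨Nat.prime_five⟩
  -- `H = 𝔽₅ P`
  obtain ⟨P, hPH, hP0, hHP⟩ := exists_eq_zmultiples_of_ne_bot_of_ne_top W 5 H hbot htop
  have hP0' : (P : W.geomPoints) ≠ 0 := fun h ↦ hP0 (Subtype.ext h)
  have hP5 : 5 • (P : W.geomPoints) = 0 := by
    have h := (mem_torsionPoints_iff _ _ (P : W.geomPoints)).mp P.2
    rwa [natCast_zsmul] at h
  rcases hdich with hfix | hquot
  · -- Branch 1: `P` is a rational point of order `5`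
    refine false_of_rational_two_torsion_of_fixed_five_torsion W h2 hP0' hP5 fun σ ↦ ?_
    have := congrArg Subtype.val (hfix σ P hPH)
    rwa [AddSubgroup.torsionBy.coe_smul] at this
  · -- Branch 2: the quotient `E/H`
    set S : AddSubgroup W.geomPoints := H.map (geomTorsion W ((5 : ℕ) : ℤ)).subtype with hS
    have hSmem : ∀ {X : W.geomPoints}, X ∈ S ↔ ∃ Y ∈ H, (Y : W.geomPoints) = X := by
      intro X; rw [hS, AddSubgroup.mem_map]; rfl
    have hSstab : ∀ (σ : absoluteGaloisGroup ℚ) (X : W.geomPoints), X ∈ S → σ • X ∈ S := by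
      intro σ X hX
      obtain ⟨Y, hY, rfl⟩ := hSmem.mp hX
      exact hSmem.mpr ⟨σ • Y, hst σ Y hY, by rw [AddSubgroup.torsionBy.coe_smul]⟩
    have hSeq : S = AddSubgroup.zmultiples (P : W.geomPoints) := by
      rw [hS, hHP, AddMonoidHom.map_zmultiples]; rfl
    have hordP : addOrderOf (P : W.geomPoints) = 5 := addOrderOf_eq_prime hP5 hP0'
    have hScard : Nat.card S = 5 := by rw [hSeq, Nat.card_zmultiples, hordP]
    have hSfin : (S : Set W.geomPoints).Finite := by
      have h : Nat.card S ≠ 0 := by rw [hScard]; decide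
      exact Nat.finite_of_card_ne_zero h
    obtain ⟨E', hE', g, -, hker, -, -⟩ := W.exists_isogeny_ker_eq_and_comp_eq_nsmul_holds S hSfin hSstab
    haveI := hE'
    have hgker : ∀ X : W.geomPoints, g X = 0 ↔ X ∈ S := fun X ↦ by
      rw [← hker]; rfl
    -- a point `Q ∈ E[5] ∖ H` and its image
    obtain ⟨Q, hQH⟩ : ∃ Q : geomTorsion W ((5 : ℕ) : ℤ), Q ∉ H := by
      by_contra h
      push Not at h
      exact htop ((AddSubgroup.eq_top_iff' H).mpr h)
    have hQ5 : 5 • (Q : W.geomPoints) = 0 := by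
      have h := (mem_torsionPoints_iff _ _ (Q : W.geomPoints)).mp Q.2
      rwa [natCast_zsmul] at h
    have hgQ0 : g (Q : W.geomPoints) ≠ 0 := fun h ↦ by
      obtain ⟨Y, hY, hYQ⟩ := hSmem.mp ((hgker _).mp h)
      exact hQH (Subtype.ext hYQ ▸ hY)
    have hgQ5 : 5 • g (Q : W.geomPoints) = 0 := by rw [← map_nsmul, hQ5, map_zero]
    have hgQfix : ∀ σ : absoluteGaloisGroup ℚ, σ • g (Q : W.geomPoints) = g Q := by
      intro σ
      rw [← g.map_smul, ← sub_eq_zero, ← map_sub, hgker]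
      have h := hquot σ Q
      exact hSmem.mpr ⟨σ • Q - Q, h, by
        rw [AddSubgroup.coe_sub, AddSubgroup.torsionBy.coe_smul]⟩
    -- the `2`-torsion of `E'` is `g(E[2])`, hence rational
    have h2' : ∀ (σ : absoluteGaloisGroup ℚ) (X' : E'.geomPoints), 2 • X' = 0 → σ • X' = X' := by
      -- `g` restricted to `E[2] → E'[2]` is injective, hence bijective (both have `4` elements)
      have h2K : ((2 : ℕ) : ℚ) ≠ 0 := by norm_num
      haveI : Finite (geomTorsion W ((2 : ℕ) : ℤ)) := finite_geomTorsion_natCast W two_ne_zero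
      haveI : Finite (geomTorsion E' ((2 : ℕ) : ℤ)) := finite_geomTorsion_natCast E' two_ne_zero
      have hmapsTo : ∀ X : geomTorsion W ((2 : ℕ) : ℤ),
          g (X : W.geomPoints) ∈ geomTorsion E' ((2 : ℕ) : ℤ) := fun X ↦ by
        rw [geomTorsion, AddSubgroup.torsionBy.nsmul_iff, ← map_nsmul,
          AddSubgroup.torsionBy.nsmul_iff.mp X.2, map_zero]
      let g₂ : geomTorsion W ((2 : ℕ) : ℤ) → geomTorsion E' ((2 : ℕ) : ℤ) :=
        fun X ↦ ⟨g (X : W.geomPoints), hmapsTo X⟩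
      have hg₂inj : Function.Injective g₂ := by
        intro X Y hXY
        have h0 : g ((X : W.geomPoints) - Y) = 0 := by
          rw [map_sub, sub_eq_zero]; exact congrArg Subtype.val hXY
        rw [hgker] at h0
        -- an element of `S` killed by `2` and by `5` is `0`
        have h2XY : 2 • ((X : W.geomPoints) - Y) = 0 := by
          rw [nsmul_sub, AddSubgroup.torsionBy.nsmul_iff.mp X.2, AddSubgroup.torsionBy.nsmul_iff.mp Y.2,
            sub_zero]
        have h5XY : 5 • ((X : W.geomPoints) - Y) = 0 := by
          rw [hSeq, AddSubgroup.mem_zmultiples_iff] at h0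
          obtain ⟨k, hk⟩ := h0
          rw [← hk, smul_comm, hP5, zsmul_zero]
        have : (X : W.geomPoints) - Y = 0 := by
          have h6 : 6 • ((X : W.geomPoints) - Y) = 0 := by
            rw [show (6 : ℕ) = 3 * 2 by rfl, mul_nsmul', h2XY, smul_zero]
          have h : (6 - 5) • ((X : W.geomPoints) - Y) = 0 := by
            rw [sub_nsmul _ (by norm_num : 5 ≤ 6), h6, h5XY]; abel
          rwa [show 6 - 5 = 1 by rfl, one_nsmul] at h
        exact Subtype.ext (sub_eq_zero.mp this)
      have hcard : Nat.card (geomTorsion E' ((2 : ℕ) : ℤ)) ≤ Nat.card (geomTorsion W ((2 : ℕ) : ℤ)) := by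
        rw [natCard_geomTorsion_eq_sq W h2K, natCard_geomTorsion_eq_sq E' h2K]
      have hg₂bij : Function.Bijective g₂ := hg₂inj.bijective_of_nat_card_le hcard
      intro σ X' hX'
      obtain ⟨X, hX⟩ := hg₂bij.2 ⟨X', AddSubgroup.torsionBy.nsmul_iff.mpr hX'⟩
      have hgX : g (X : W.geomPoints) = X' := congrArg Subtype.val hX
      rw [← hgX, ← g.map_smul, h2 σ X (AddSubgroup.torsionBy.nsmul_iff.mp X.2)]
    exact false_of_rational_two_torsion_of_fixed_five_torsion E' h2' hgQ0 hgQ5 hgQfix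

end Summit.ABC.ABC.Theorems

end
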